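import Summits.SmoothPoincare4.SmoothPoincare4.Theorems.RootDecompAEDoublesBeyondShadowTwoLedgerPeel

/-!
# Grade-four ownership ledger `LocalTableLE4 → GradeFourDichotomy` for KMN encoding graphs, part 12/15: the unimodular start; step L0

§12 `Tab`, `um_full` (`H₁ = 0`), `ownLetter`, `um_top` (the block gluings × used letters is unimodular once all
gluings are tree edges) and step L0 `tree_eq_true_of_presentsTrivialGroup` (a non-tree stable letter survives in the
abelianisation).

THE FAMILY (14 modules `Theorems/RootDecompAEDoublesBeyondShadowTwoLedger*.lean` + the closing module
`Theorems/RootDecompAEDoublesBeyondShadowTwoStubLedgerFour.lean`, one namespace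
`Summit.SmoothPoincare4.SmoothPoincare4.Theorems.RootDecompAEDoublesBeyondShadowTwoStubLedgerFour`, linearly chained
imports, split by topic to respect the 400-line bound on proof files).
-/

open Function
open Literature.Topology.FourManifolds

set_option linter.dupNamespace false

noncomputable section

namespace Summit.SmoothPoincare4.SmoothPoincare4.Theorems.RootDecompAEDoublesBeyondShadowTwoStubLedgerFour

/-! ## §12 The unimodular start and step L0 -/

namespace ShadowGraph

variable (G₄ : ShadowGraph)

/-! ### The unimodular start: `H₁ = 0` makes the gluing block of the exponent table unimodular -/

/-- The FULL exponent table of `P(G₄)`: exponent sum of the letter `g` in the relator `r`. -/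
def Tab (r : G₄.Rel) (g : G₄.Gen) : ℤ := expo g (G₄.relator r)

/-- The full exponent table is unimodular when `P(G₄)` presents the trivial group (`H₁ = 0`). -/
theorem um_full₄ {n : ℕ} (eg : G₄.Gen ≃ Fin n) (er : G₄.Rel ≃ Fin n)
    (h : (G₄.presentation eg er).PresentsTrivialGroup) :
    UM G₄.Tab (Finset.univ : Finset G₄.Rel) (Finset.univ : Finset G₄.Gen) := by
  classical
  have hdet := isUnit_det_expoMat (G₄.presentation eg er)
    ((BalancedPresentation.presentsTrivialGroup_iff_normalClosure_eq_top _).mp h)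
  let eR : ((Finset.univ : Finset G₄.Rel) : Type) ≃ G₄.Rel := Equiv.subtypeUnivEquiv (fun x => Finset.mem_univ x)
  let eC : ((Finset.univ : Finset G₄.Gen) : Type) ≃ G₄.Gen := Equiv.subtypeUnivEquiv (fun x => Finset.mem_univ x)
  let β : ((Finset.univ : Finset G₄.Rel) : Type) ≃ ((Finset.univ : Finset G₄.Gen) : Type) :=
    eR.trans (er.trans (eg.symm.trans eC.symm))
  refine ⟨β, ?_⟩
  have e : blk G₄.Tab Finset.univ Finset.univ β = (expoMat (G₄.presentation eg er)).submatrix ⇑(eR.trans er) ⇑(eR.trans er) := by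
    ext x y
    simp only [blk, expoMat, Tab, presentation, Matrix.submatrix_apply, Matrix.of_apply, Equiv.trans_apply,
      expo_map_equiv, Equiv.symm_apply_apply]
    rfl
  rw [e, Matrix.det_submatrix_equiv_self]
  exact hdet

/-- The owner letter of a ONE-LETTER relator (killing relators of stable letters and of unused spine letters),
and a dummy value on gluing relators. -/
def ownLetter : G₄.Rel → G₄.Gen
  | Sum.inl e => Sum.inr e
  | Sum.inr (Sum.inl e) => Sum.inr e.1
  | Sum.inr (Sum.inr p) => Sum.inl p.1

/-- At the start of the peeling every gluing is a row. -/
theorem rows_univ₄ : G₄.rows Finset.univ ∅ = Finset.univ := by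
  ext e; simp [mem_rows₄]

/-- THE UNIMODULAR START.  If `P(G₄)` presents the trivial group and all gluings are tree edges, the block
`(gluing rows) × (used letters)` of the exponent table is unimodular: the full table is (`H₁ = 0`), and the
one-letter relators form a permutation block on the complementary letters. -/
theorem um_top₄ (hall : ∀ e, G₄.tree e = true) {n : ℕ} (eg : G₄.Gen ≃ Fin n) (er : G₄.Rel ≃ Fin n)
    (h : (G₄.presentation eg er).PresentsTrivialGroup) :
    UM G₄.tab (G₄.rows Finset.univ ∅) (G₄.cols Finset.univ) := by
  classical
  have hfull := G₄.um_full₄ eg er h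
  -- split the relator indices into one-letter relators `ru` and gluing relators `r'`
  set ru : Finset G₄.Rel := Finset.univ.map ⟨Sum.inr, Sum.inr_injective⟩ with hru
  set r' : Finset G₄.Rel := Finset.univ.map ⟨Sum.inl, Sum.inl_injective⟩ with hr'
  set cu : Finset G₄.Gen := Finset.univ.filter fun g => g ∉ G₄.cols Finset.univ with hcu
  have hrows : (Finset.univ : Finset G₄.Rel) = ru ∪ r' := by
    ext r
    simp only [Finset.mem_univ, Finset.mem_union, true_iff]
    rcases r with e | x
    · exact Or.inr (by simp [hr'])
    · exact Or.inl (by simp [hru])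
  have hcolsU : (Finset.univ : Finset G₄.Gen) = cu ∪ G₄.cols Finset.univ := by
    ext g
    simp only [Finset.mem_univ, Finset.mem_union, hcu, Finset.mem_filter, true_and, true_iff]
    tauto
  have hdr : Disjoint ru r' := by
    rw [Finset.disjoint_left]
    intro r h1 h2
    simp only [hru, hr', Finset.mem_map, Finset.mem_univ, Function.Embedding.coeFn_mk, true_and] at h1 h2
    obtain ⟨x, rfl⟩ := h1
    obtain ⟨e, he⟩ := h2
    cases he
  have hdc : Disjoint cu (G₄.cols Finset.univ) := by
    rw [Finset.disjoint_left]
    intro g h1 h2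
    simp only [hcu, Finset.mem_filter] at h1
    exact h1.2 h2
  -- the one-letter relators are in bijection with the complementary letters
  have hcu_eq : cu = ru.image G₄.ownLetter := by
    ext g
    simp only [hcu, hru, Finset.mem_filter, Finset.mem_univ, true_and, Finset.mem_image, Finset.mem_map,
      Function.Embedding.coeFn_mk]
    constructor
    · intro hg
      rcases g with ⟨v, i⟩ | e
      · have hi : (G₄.piece v).rank ≤ (i : ℕ) := by
          rw [inl_mem_cols] at hg; push Not at hg; exact hg (Finset.mem_univ v)
        exact ⟨Sum.inr (Sum.inr ⟨(v, i), hi⟩), by simp, rfl⟩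
      · exact ⟨Sum.inr (Sum.inl ⟨e, hall e⟩), by simp, rfl⟩
    · rintro ⟨r, ⟨x, rfl⟩, rfl⟩
      rcases x with ⟨e, he⟩ | ⟨p, hp⟩
      · exact G₄.inr_not_mem_cols₄ _ _
      · simp only [ownLetter]
        rw [show p = (p.1, p.2) from rfl, inl_mem_cols]
        push Not
        intro _
        exact hp
  have hinjOn : Set.InjOn G₄.ownLetter ru := by
    intro r₁ h₁ r₂ h₂ heq
    simp only [hru, Finset.coe_map, Function.Embedding.coeFn_mk, Set.mem_image, Finset.coe_univ, Set.mem_univ,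
      true_and] at h₁ h₂
    obtain ⟨x₁, rfl⟩ := h₁
    obtain ⟨x₂, rfl⟩ := h₂
    rcases x₁ with ⟨e₁, he₁⟩ | ⟨p₁, hp₁⟩ <;> rcases x₂ with ⟨e₂, he₂⟩ | ⟨p₂, hp₂⟩ <;>
      simp only [ownLetter, Sum.inr.injEq, Sum.inl.injEq, reduceCtorEq] at heq ⊢
    · subst heq; rfl
    · subst heq; rfl
  have hcard : ru.card = cu.card := by
    rw [hcu_eq, Finset.card_image_of_injOn hinjOn]
  have hz : ∀ i ∈ ru, ∀ j ∈ G₄.cols Finset.univ, G₄.Tab i j = 0 := by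
    intro r hr g hg
    simp only [hru, Finset.mem_map, Finset.mem_univ, Function.Embedding.coeFn_mk, true_and] at hr
    obtain ⟨x, rfl⟩ := hr
    obtain ⟨v, i, rfl, -, hi⟩ := (G₄.mem_cols_iff₄ _ _).mp hg
    rcases x with ⟨e, he⟩ | ⟨p, hp⟩
    · simp [Tab, relator, stable]
    · simp only [Tab, relator, expo_of]
      rw [if_neg]
      rintro h
      simp only [Sum.inl.injEq] at h
      rw [h] at hp
      exact absurd hi (not_lt.mpr hp)
  rw [hrows, hcolsU] at hfull
  obtain ⟨-, hU⟩ := hfull.split_bot hdr hdc hcard hz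
  -- transport the gluing rows to `Fin m`
  let f : ((G₄.rows Finset.univ ∅ : Finset (Fin G₄.m)) : Type) ≃ (r' : Type) :=
    { toFun := fun x => ⟨Sum.inl x.1, by simp [hr']⟩
      invFun := fun y => ⟨Sum.elim id (fun _ => (⟨0, by
          obtain ⟨y, hy⟩ := y
          simp only [hr', Finset.mem_map, Finset.mem_univ, Function.Embedding.coeFn_mk, true_and] at hy
          obtain ⟨e, -⟩ := hy
          exact Fin.pos e⟩ : Fin G₄.m)) y.1, by rw [rows_univ₄]; exact Finset.mem_univ _⟩
      left_inv := fun x => by simp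
      right_inv := fun y => by
        obtain ⟨y, hy⟩ := y
        simp only [hr', Finset.mem_map, Finset.mem_univ, Function.Embedding.coeFn_mk, true_and] at hy
        obtain ⟨e, rfl⟩ := hy
        rfl }
  exact UM.of_rowEquiv f (fun x g => by simp [f, tab, Tab, relator]) hU

end ShadowGraph

/-! ### Step L0 (all gluings are tree edges) -/

namespace ShadowGraph

variable (G₄ : ShadowGraph)

/-! ### Step L0 (copied from the skeleton, `Lines/grade_one_ac.lean` §6.1): non-tree edges carry a character onto ℤ -/

/-- The exponent-sum character of the stable letter `t_e`: `t_e ↦ 1 ∈ ℤ`, every other generator `↦ 0`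
(written multiplicatively). -/
def stableCharacter (e : Fin G₄.m) : FreeGroup G₄.Gen →* Multiplicative ℤ :=
  FreeGroup.lift fun g => if g = Sum.inr e then Multiplicative.ofAdd 1 else 1

/-- Port words contain no stable letter. -/
theorem stableCharacter_portWordAt₄ (e : Fin G₄.m) (p : Fin G₄.k × ℕ) :
    G₄.stableCharacter e (G₄.portWordAt p) = 1 := by
  have h : (G₄.stableCharacter e).comp (G₄.embed p.1) = 1 := by
    refine FreeGroup.ext_hom _ _ fun i => ?_
    simp [stableCharacter, embed]
  change ((G₄.stableCharacter e).comp (G₄.embed p.1)) ((G₄.piece p.1).portWord p.2) = 1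
  rw [h]; rfl

/-- The stable letter `t_e` has exponent sum zero in every gluing relator. -/
theorem stableCharacter_gluingRelator₄ (e e' : Fin G₄.m) :
    G₄.stableCharacter e (G₄.gluingRelator e') = 1 := by
  unfold gluingRelator
  split_ifs <;> simp [map_mul, map_inv, stableCharacter_portWordAt₄, mul_comm]

/-- The character `t_e ↦ 1` kills every relator of `P(G₄)` as soon as `e` is NOT a tree edge. -/
theorem stableCharacter_relator₄ (e : Fin G₄.m) (he : G₄.tree e = false) (r : G₄.Rel) :
    G₄.stableCharacter e (G₄.relator r) = 1 := by
  rcases r with e' | ⟨e', he'⟩ | p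
  · exact G₄.stableCharacter_gluingRelator₄ e e'
  · have hne : (Sum.inr e' : G₄.Gen) ≠ Sum.inr e := by
      intro h
      have : e' = e := Sum.inr_injective h
      rw [this] at he'
      simp [he] at he'
    simp [relator, stable, stableCharacter, hne]
  · simp [relator, stableCharacter]

/-- **Step L0 (tree lemma).**  If the uniform presentation `P(G₄)` of an encoding graph presents the trivial group,
then EVERY glued pair is a tree edge: otherwise the stable letter `t_e` of a non-tree gluing survives in `H₁` (the
character `t_e ↦ 1 ∈ ℤ` kills all relators).  No admissibility hypothesis is needed. -/
theorem tree_eq_true_of_presentsTrivialGroup₄ {n : ℕ} (eg : G₄.Gen ≃ Fin n) (er : G₄.Rel ≃ Fin n)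
    (h : (G₄.presentation eg er).PresentsTrivialGroup) (e : Fin G₄.m) : G₄.tree e = true := by
  by_contra he
  have he' : G₄.tree e = false := by simpa using he
  -- transport the character to `FreeGroup (Fin n)`
  let ψ : FreeGroup (Fin n) →* Multiplicative ℤ := (G₄.stableCharacter e).comp (FreeGroup.map eg.symm)
  have hψmap : ∀ x : FreeGroup G₄.Gen, ψ (FreeGroup.map eg x) = G₄.stableCharacter e x := by
    intro x
    have hc : (ψ.comp (FreeGroup.map eg)) = G₄.stableCharacter e := by
      refine FreeGroup.ext_hom _ _ fun g => ?_
      simp [ψ]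
    exact congrArg (fun φ : FreeGroup G₄.Gen →* Multiplicative ℤ => φ x) hc
  have hrel : ∀ r ∈ Set.range (G₄.presentation eg er), FreeGroup.lift (fun i => ψ (FreeGroup.of i)) r = 1 := by
    rintro r ⟨j, rfl⟩
    have hl : FreeGroup.lift (fun i => ψ (FreeGroup.of i)) = ψ := by
      refine FreeGroup.ext_hom _ _ fun i => ?_
      simp
    rw [hl]
    show ψ (FreeGroup.map eg (G₄.relator (er.symm j))) = 1
    rw [hψmap]
    exact G₄.stableCharacter_relator₄ e he' _
  -- the induced map on the (trivial) presented group sends `x_{eg (t_e)}` to `1 ∈ ℤ`, absurd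
  have hsub : Subsingleton (PresentedGroup (Set.range (G₄.presentation eg er))) := h
  have h1 : PresentedGroup.toGroup hrel (PresentedGroup.of (eg (Sum.inr e))) = ψ (FreeGroup.of (eg (Sum.inr e))) :=
    PresentedGroup.toGroup.of hrel
  have h2 : (PresentedGroup.of (eg (Sum.inr e)) : PresentedGroup (Set.range (G₄.presentation eg er))) = 1 :=
    Subsingleton.elim _ _
  rw [h2, map_one] at h1
  have h3 : ψ (FreeGroup.of (eg (Sum.inr e))) = Multiplicative.ofAdd (1 : ℤ) := by
    simp [ψ, stableCharacter]
  rw [h3] at h1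
  exact absurd (Multiplicative.ofAdd.injective (h1.symm.trans rfl)) (by norm_num)

end ShadowGraph

end Summit.SmoothPoincare4.SmoothPoincare4.Theorems.RootDecompAEDoublesBeyondShadowTwoStubLedgerFour
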